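import Summits.ValiantsHypothesis.ValiantsHypothesis.Theorems.BarrierLeverPartitionMinorsHitByVPMooreBallBallDefs

/-!
# Route BarrierLever — item `PartitionMinorsHitByVP` (stmt-ValiantsHypothesis-19717):
# the LOW-ORDER PEEL of the Moore–ball determinant, and «BALL ROWS × BALL COLUMNS» for EVERY radius

Helper file (`--supports stmt-ValiantsHypothesis-19717`; cell valiant-natproofs, rung V4, 𝒟-side door (c); prover
seat val-np-p6 gen 6). Definition-free (the objects `Ball`, `ballEta`, `ballWt`, `bbMatrix`, `ballSplit` are in
`…HitByVPMooreBallBallDefs`). Closes NO item.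

CONTEXT. `…HitByVPMooreBall` typed the cell's conjectures F_p(h,e) (`MooreBallNonsingularChar p h e`: the
characteristic-`p` generalized Vandermonde `det [η_{u i}^{Σ_{c∈w j} p^c}]` on Hamming-ball rows is nonzero for EVERY
injective column family `w`) with the arrows F_p ⇒ T1 ⇒ «ball rows × ANY columns», and proved them for `e ≤ 1`;
F_2 is false at `(5,2)` (`…MooreBallNegative`), F_3 has no known failure (census of val-np-p6 g5). This file proves the
FIRST case with UNBOUNDED radius: the column family is the ball itself.

THE PEEL (`bbMatrix_det_ne_zero_peel`, any prime `p`). Write `T` for the variable of node `0` and split rows AND columns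
of `B([n+1], e+1)` by «contains `0`» (`ballSplit`). Subtract from the row of `S' ∪ {0}` the row of `S'` (a unimodular row
operation; here the DOWN-CLOSEDNESS of the ball on the node side is used). By Frobenius, `(T + η_{S'})^{p^{d 0} + m} −
η_{S'}^{p^{d 0}+m} = T^{p^{d 0}} · (η_{S'}^m + T·g)` when `p^{d 0 + 1} ∣ m`, while for a column avoiding digit `0` the
differenced entry is divisible by `T^{p^{d 0}+1}`. Hence `det = T^{p^{d 0}·|B(n,e)|} · det Q` with `Q(0)` BLOCK-TRIANGULAR,
diagonal blocks = the two Pascal pieces `BB(n, e+1)`, `BB(n, e)` (digit exponents shifted, `d ∘ succ`). So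
`det BB(n+1,e+1) ≠ 0 ⇐ det BB(n,e+1) ≠ 0 ∧ det BB(n,e) ≠ 0` — and by induction (`bbMatrix_det_ne_zero`) the ball × ball
Moore determinant is nonzero for every `p`, `n`, `e`. (For a GENERAL column family the lowest `T`-order is the sum of the
`|B(n,e)|` smallest `p^{min W}` and its coefficient is a two-storey determinant; it is a product of two Pascal pieces exactly
when those columns are determined WITHOUT TIES and have distinct tails `W ∖ min W` — among down-closed families only the
ball has this at every stage (seat census); the tied, glued coefficient is where F_3 now lives — seat memo RESIDUE-v8.)

RESULTS (unconditional, every prime `p`, every `h`, every radius `e`):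
* `bbMatrix_det_ne_zero` — `det [η_S^{Σ_{c∈W} p^{d c}}]_{S,W ∈ B([n],e)} ≠ 0` in `𝔽_p[Y]` for strictly increasing `d`;
* `mooreBall_ballColumns_det_ne_zero`, `frobDet_ne_zero_ballRows_ballColumns` — the same in the tree's variables
  `Option (Fin h)` and for arbitrary enumerations `u`, `w` of the ball (the hypotheses of `MooreBallNonsingularChar`);
* `ballRowsUniversal_ballColumns` — T1 holds on these layouts (a numeric complex additive table exists);
* **`partitionMinor_hit_ballRows_ballColumns`** — for `h ≥ 2` and every `e`, every layout «rows = `B([h],e)` in any order ×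
  columns = `B([h],e)` in any order» (`r = Σ_{k≤e} C(h,k)`, exponential in `h` for `e = ⌊h/2⌋`) is hit inside
  `SmallCircuits ℂ (h+h) 5`.

WHAT THIS IS NOT: one layout class (both sides a full ball of the same radius); F_3 / T1 for general columns stay
OPEN; for bounded `e` these layouts were already inside the sparse regime `r ≤ h²+1` of `…HiddenStatesSimplex` — the
new content is unbounded `e` with a fixed size exponent `5`; nothing on crux 14610 or VP vs VNP.
-/

set_option linter.dupNamespace false
namespace Summit.ValiantsHypothesis.ValiantsHypothesis.Theorems.BarrierLever.FrobeniusDoor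

open Finset MvPolynomial Matrix
open Literature.Barriers.ValiantsHypothesis

noncomputable section

variable (p : ℕ)

/-! ## 3. Node forms and weights under the split -/
/-- Node form of a shifted set = the shifted (renamed) node form. -/
theorem ballEta_map_succEmb (n : ℕ) (S : Finset (Fin n)) :
    ballEta p (n + 1) (S.map (Fin.succEmb n)) = rename Fin.succ (ballEta p n S) := by
  simp only [ballEta, map_add, map_sum, rename_X, Finset.sum_map, Fin.coe_succEmb, Fin.succ_last,
    Fin.succ_castSucc]

/-- Node form of `insert 0 (shift S)` = `X 0 +` the shifted node form of `S`. -/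
theorem ballEta_insert_zero (n : ℕ) (S : Finset (Fin n)) :
    ballEta p (n + 1) (insert 0 (S.map (Fin.succEmb n))) = X 0 + rename Fin.succ (ballEta p n S) := by
  rw [← ballEta_map_succEmb]
  simp only [ballEta]
  rw [Finset.sum_insert (by simp [Fin.succ_ne_zero]), Fin.castSucc_zero]
  ring
/-- Weight of a shifted digit set = weight for the shifted exponent map `d ∘ succ`. -/
theorem ballWt_map_succEmb (n : ℕ) (d : Fin (n + 1) → ℕ) (W : Finset (Fin n)) :
    ballWt p (n + 1) d (W.map (Fin.succEmb n)) = ballWt p n (d ∘ Fin.succ) W := by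
  simp [ballWt, Finset.sum_map]
/-- Weight of `insert 0 (shift W)` = `p ^ d 0 +` the shifted weight. -/
theorem ballWt_insert_zero (n : ℕ) (d : Fin (n + 1) → ℕ) (W : Finset (Fin n)) :
    ballWt p (n + 1) d (insert 0 (W.map (Fin.succEmb n))) = p ^ d 0 + ballWt p n (d ∘ Fin.succ) W := by
  rw [← ballWt_map_succEmb, ballWt, ballWt, Finset.sum_insert (by simp [Fin.succ_ne_zero])]
/-- Every weight over the digits `≥ 1` is a multiple of `p ^ (d 0 + 1)` when `d 0 < d c` for `c ≠ 0`. -/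
theorem pow_succ_dvd_ballWt (n : ℕ) (d : Fin (n + 1) → ℕ) (hd : ∀ c : Fin n, d 0 < d c.succ)
    (W : Finset (Fin n)) : p ^ (d 0 + 1) ∣ ballWt p n (d ∘ Fin.succ) W := by
  unfold ballWt
  exact Finset.dvd_sum fun c _ => pow_dvd_pow p (hd c)
/-- `finSuccEquiv` sends a polynomial in the shifted variables to a constant. -/
theorem finSuccEquiv_rename_succ (m : ℕ) (f : MvPolynomial (Fin m) (ZMod p)) :
    MvPolynomial.finSuccEquiv (ZMod p) m (rename Fin.succ f) = Polynomial.C f := by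
  have h1 : ((MvPolynomial.finSuccEquiv (ZMod p) m).toAlgHom.comp (rename Fin.succ) : MvPolynomial (Fin m) (ZMod p) →ₐ[ZMod p] _) =
      (Polynomial.CAlgHom : MvPolynomial (Fin m) (ZMod p) →ₐ[ZMod p] Polynomial (MvPolynomial (Fin m) (ZMod p))) := by
    apply MvPolynomial.algHom_ext
    intro i
    simp [MvPolynomial.finSuccEquiv_X_succ, Polynomial.CAlgHom]
  exact congrArg (fun g : MvPolynomial (Fin m) (ZMod p) →ₐ[ZMod p] Polynomial (MvPolynomial (Fin m) (ZMod p)) => g f) h1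

/-! ## 4. Two divisibility lemmas in characteristic `p` -/
section CharPLemmas
variable [Fact p.Prime] {R : Type*} [CommRing R] [CharP R p]

/-- If `p^(k+1) ∣ m` then `X^(p^(k+1))` divides `(X + C a)^m − C (a^m)` in `R[X]` (`R` of characteristic `p`). -/
theorem X_pow_dvd_add_pow_sub (k m : ℕ) (hm : p ^ (k + 1) ∣ m) (a : R) :
    (Polynomial.X : Polynomial R) ^ p ^ (k + 1) ∣ (Polynomial.X + Polynomial.C a) ^ m - Polynomial.C (a ^ m) := by
  obtain ⟨m', rfl⟩ := hm
  have hfrob : (Polynomial.X + Polynomial.C a : Polynomial R) ^ p ^ (k + 1) =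
      Polynomial.X ^ p ^ (k + 1) + Polynomial.C a ^ p ^ (k + 1) := add_pow_char_pow ..
  rw [pow_mul, hfrob, map_pow, pow_mul]
  have := sub_dvd_pow_sub_pow (Polynomial.X ^ p ^ (k + 1) + Polynomial.C a ^ p ^ (k + 1))
    (Polynomial.C a ^ p ^ (k + 1) : Polynomial R) m'
  rwa [add_sub_cancel_right] at this

/-- The `q = p^k` version: `(X + C a)^(q + m) − C (a^(q+m)) = X^q · (C (a^m) + X · g)` for some `g`, when
`p^(k+1) ∣ m`. -/
theorem add_pow_sub_eq_X_pow_mul (k m : ℕ) (hm : p ^ (k + 1) ∣ m) (a : R) :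
    ∃ g : Polynomial R, (Polynomial.X + Polynomial.C a) ^ (p ^ k + m) - Polynomial.C (a ^ (p ^ k + m)) =
      Polynomial.X ^ p ^ k * (Polynomial.C (a ^ m) + Polynomial.X * g) := by
  obtain ⟨g₀, hg₀⟩ := X_pow_dvd_add_pow_sub p k m hm a
  have hfrob : (Polynomial.X + Polynomial.C a : Polynomial R) ^ p ^ k =
      Polynomial.X ^ p ^ k + Polynomial.C a ^ p ^ k := add_pow_char_pow ..
  have h1 : p ^ k + 1 ≤ p ^ (k + 1) := Nat.pow_lt_pow_right (Fact.out : p.Prime).one_lt (by omega)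
  obtain ⟨r, hr⟩ := Nat.exists_eq_add_of_le h1
  rw [hr] at hg₀
  refine ⟨Polynomial.X ^ r * (Polynomial.X ^ p ^ k + Polynomial.C a ^ p ^ k) * g₀, ?_⟩
  have hexp : (Polynomial.X + Polynomial.C a : Polynomial R) ^ m =
      Polynomial.C (a ^ m) + Polynomial.X ^ (p ^ k + 1 + r) * g₀ := by
    rw [← hg₀]; ring
  rw [pow_add, hfrob, hexp, map_pow, map_pow]
  ring
end CharPLemmas

/-! ## 5. The peel step: `det BB(n+1, e+1) ≠ 0` from the two Pascal pieces -/
section Peel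
variable [Fact p.Prime]

/-- **THE PEEL STEP.** If `d 0 < d c` for all `c ≠ 0` and both Pascal pieces `BB(n, e+1)`, `BB(n, e)` (for the shifted
digit exponents `d ∘ succ`) have nonzero determinant, then so has `BB(n+1, e+1)` (for `d`). Mechanism: reindex by the
split at node `0`, pass to `R[T]` (`T = Y_0`-node variable via `finSuccEquiv`), subtract from each row `S' ∪ {0}` the row `S'`;
then every entry of the bottom blocks is divisible by `T^(p^(d 0))`, exactly (bottom-left: by `T^(p^(d 0 + 1))`; bottom-right:
`T^(p^(d 0)) · (BB(n,e) + T·G)`), so `det = T^(q·|B(n,e)|) · det Q` with `Q(0)` block-triangular with diagonal blocks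
`BB(n,e+1)` and `BB(n,e)`. -/
theorem bbMatrix_det_ne_zero_peel (n e : ℕ) (d : Fin (n + 1) → ℕ) (hd : ∀ c : Fin n, d 0 < d c.succ)
    (hA : (bbMatrix p n (e + 1) (d ∘ Fin.succ)).det ≠ 0) (hB : (bbMatrix p n e (d ∘ Fin.succ)).det ≠ 0) :
    (bbMatrix p (n + 1) (e + 1) d).det ≠ 0 := by
  classical
  -- abbreviations
  set R := MvPolynomial (Fin (n + 1)) (ZMod p) with hR
  set ψ := MvPolynomial.finSuccEquiv (ZMod p) (n + 1) with hψ
  set d' : Fin n → ℕ := d ∘ Fin.succ with hd'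
  set q : ℕ := p ^ d 0 with hq
  set A : Matrix (Ball n (e + 1)) (Ball n (e + 1)) R := bbMatrix p n (e + 1) d' with hAdef
  set B : Matrix (Ball n e) (Ball n e) R := bbMatrix p n e d' with hBdef
  set A₁₂ : Matrix (Ball n (e + 1)) (Ball n e) R :=
    Matrix.of fun S' W' => ballEta p n S'.1 ^ (q + ballWt p n d' W'.1) with hA₁₂
  set σ := ballSplit n e with hσ
  set M := bbMatrix p (n + 1) (e + 1) d with hM
  -- the reindexed matrix, mapped to `R[T]`
  set PM : Matrix (Ball n (e + 1) ⊕ Ball n e) (Ball n (e + 1) ⊕ Ball n e) (Polynomial R) :=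
    ψ.toRingEquiv.toRingHom.mapMatrix (Matrix.reindex σ σ M) with hPM
  have hdetPM : PM.det = ψ M.det := by
    rw [hPM, ← RingHom.map_det, Matrix.det_reindex_self]; rfl
  -- its four blocks
  set P₁₁ : Matrix (Ball n (e + 1)) (Ball n (e + 1)) (Polynomial R) := A.map Polynomial.C with hP₁₁
  set P₁₂ : Matrix (Ball n (e + 1)) (Ball n e) (Polynomial R) := A₁₂.map Polynomial.C with hP₁₂
  set P₂₁ : Matrix (Ball n e) (Ball n (e + 1)) (Polynomial R) :=
    Matrix.of fun S' V' => (Polynomial.X + Polynomial.C (ballEta p n S'.1)) ^ ballWt p n d' V'.1 with hP₂₁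
  set P₂₂ : Matrix (Ball n e) (Ball n e) (Polynomial R) :=
    Matrix.of fun S' W' => (Polynomial.X + Polynomial.C (ballEta p n S'.1)) ^ (q + ballWt p n d' W'.1) with hP₂₂
  have hentry : ∀ i j, PM i j = ψ (ballEta p (n + 1) (σ.symm i).1 ^ ballWt p (n + 1) d (σ.symm j).1) := by
    intro i j
    simp only [hPM, RingHom.mapMatrix_apply, Matrix.map_apply, Matrix.reindex_apply, Matrix.submatrix_apply, hM,
      bbMatrix, Matrix.of_apply]
    rfl
  have hψX : ψ (X 0) = Polynomial.X := by rw [hψ]; exact MvPolynomial.finSuccEquiv_X_zero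
  have hblocks : PM = Matrix.fromBlocks P₁₁ P₁₂ P₂₁ P₂₂ := by
    refine Matrix.ext fun i j => ?_
    rw [hentry]
    rcases i with S' | S' <;> rcases j with V' | V'
    · rw [Matrix.fromBlocks_apply₁₁, hP₁₁, Matrix.map_apply, hAdef, bbMatrix, Matrix.of_apply, hσ,
        ballSplit_symm_inl, ballSplit_symm_inl, ballEta_map_succEmb, ballWt_map_succEmb, map_pow,
        finSuccEquiv_rename_succ, ← map_pow]
    · rw [Matrix.fromBlocks_apply₁₂, hP₁₂, Matrix.map_apply, hA₁₂, Matrix.of_apply, hσ, ballSplit_symm_inl,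
        ballSplit_symm_inr, ballEta_map_succEmb, ballWt_insert_zero, map_pow, finSuccEquiv_rename_succ, ← map_pow]
    · rw [Matrix.fromBlocks_apply₂₁, hP₂₁, Matrix.of_apply, hσ, ballSplit_symm_inr, ballSplit_symm_inl,
        ballEta_insert_zero, ballWt_map_succEmb, map_pow, map_add, hψX, finSuccEquiv_rename_succ]
    · rw [Matrix.fromBlocks_apply₂₂, hP₂₂, Matrix.of_apply, hσ, ballSplit_symm_inr, ballSplit_symm_inr,
        ballEta_insert_zero, ballWt_insert_zero, map_pow, map_add, hψX, finSuccEquiv_rename_succ]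
  -- row differencing: subtract row `S'` (top block) from row `S' ∪ {0}` (bottom block)
  set E : Matrix (Ball n e) (Ball n (e + 1)) (Polynomial R) :=
    Matrix.of fun S' T' => if T' = ballIncl n e S' then 1 else 0 with hE
  have hEmul' : ∀ {κ : Type} (N : Matrix (Ball n (e + 1)) κ (Polynomial R)) S' j,
      (E * N) S' j = N (ballIncl n e S') j := by
    intro κ N S' j
    rw [Matrix.mul_apply, Finset.sum_eq_single (ballIncl n e S')]
    · simp [hE]
    · intro T' _ hT'; simp [hE, hT']
    · intro h; exact absurd (Finset.mem_univ _) h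
  set L : Matrix (Ball n (e + 1) ⊕ Ball n e) (Ball n (e + 1) ⊕ Ball n e) (Polynomial R) :=
    Matrix.fromBlocks 1 0 (-E) 1 with hL
  have hdetL : L.det = 1 := by rw [hL, Matrix.det_fromBlocks_zero₁₂, Matrix.det_one, Matrix.det_one, mul_one]
  have hLP : L * PM = Matrix.fromBlocks P₁₁ P₁₂ (P₂₁ - E * P₁₁) (P₂₂ - E * P₁₂) := by
    rw [hblocks, hL, Matrix.fromBlocks_multiply]
    simp only [Matrix.one_mul, Matrix.zero_mul, add_zero, Matrix.neg_mul]
    congr 1 <;> abel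
  -- divisibility of the differenced bottom blocks
  have hdvd : ∀ W' : Finset (Fin n), p ^ (d 0 + 1) ∣ ballWt p n d' W' := pow_succ_dvd_ballWt p n d hd
  have h21 : ∀ S' V', ∃ g : Polynomial R, (P₂₁ - E * P₁₁) S' V' = Polynomial.X ^ q * (Polynomial.X * g) := by
    intro S' V'
    obtain ⟨g₀, hg₀⟩ := X_pow_dvd_add_pow_sub p (R := R) (d 0) _ (hdvd V'.1) (ballEta p n S'.1)
    have h1 : p ^ d 0 + 1 ≤ p ^ (d 0 + 1) := Nat.pow_lt_pow_right (Fact.out : p.Prime).one_lt (by omega)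
    obtain ⟨r, hr⟩ := Nat.exists_eq_add_of_le h1
    rw [hr] at hg₀
    refine ⟨Polynomial.X ^ r * g₀, ?_⟩
    rw [Matrix.sub_apply, hEmul', hP₂₁, hP₁₁, Matrix.of_apply, Matrix.map_apply, hAdef, bbMatrix, Matrix.of_apply]
    show _ - Polynomial.C (ballEta p n S'.1 ^ ballWt p n d' V'.1) = _
    rw [hg₀, hq]; ring
  have h22 : ∀ S' W', ∃ g : Polynomial R,
      (P₂₂ - E * P₁₂) S' W' = Polynomial.X ^ q * (Polynomial.C (B S' W') + Polynomial.X * g) := by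
    intro S' W'
    obtain ⟨g, hg⟩ := add_pow_sub_eq_X_pow_mul p (R := R) (d 0) _ (hdvd W'.1) (ballEta p n S'.1)
    refine ⟨g, ?_⟩
    rw [Matrix.sub_apply, hEmul', hP₂₂, hP₁₂, Matrix.of_apply, Matrix.map_apply, hA₁₂, Matrix.of_apply, hBdef, bbMatrix,
      Matrix.of_apply]
    exact hg
  choose H hH using h21
  choose G hG using h22
  set Q : Matrix (Ball n (e + 1) ⊕ Ball n e) (Ball n (e + 1) ⊕ Ball n e) (Polynomial R) :=
    Matrix.fromBlocks P₁₁ P₁₂ (Matrix.of fun S' V' => Polynomial.X * H S' V')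
      (B.map Polynomial.C + Matrix.of fun S' W' => Polynomial.X * G S' W') with hQ
  have hfactor : L * PM = Matrix.fromBlocks 1 0 0 ((Polynomial.X : Polynomial R) ^ q • (1 : Matrix (Ball n e) (Ball n e) _)) * Q := by
    rw [hLP, hQ, Matrix.fromBlocks_multiply]
    simp only [Matrix.one_mul, Matrix.zero_mul, add_zero, zero_add, Matrix.smul_mul, Matrix.one_mul]
    congr 1
    · ext S' V'; rw [hH, Matrix.smul_apply, Matrix.of_apply, smul_eq_mul]
    · ext S' W'; rw [hG, Matrix.smul_apply, Matrix.add_apply, Matrix.map_apply, Matrix.of_apply, smul_eq_mul]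
  have hdetQ0 : (Polynomial.evalRingHom (0 : R)) Q.det = A.det * B.det := by
    rw [RingHom.map_det]
    have hQ0 : (Polynomial.evalRingHom (0 : R)).mapMatrix Q = Matrix.fromBlocks A A₁₂ 0 B := by
      refine Matrix.ext fun i j => ?_
      rw [RingHom.mapMatrix_apply, Matrix.map_apply, hQ]
      rcases i with S' | S' <;> rcases j with V' | V'
      · simp [hP₁₁]
      · simp [hP₁₂]
      · simp
      · simp
    rw [hQ0, Matrix.det_fromBlocks_zero₂₁]
  have hdetQ : Q.det ≠ 0 := by
    intro h0
    apply mul_ne_zero hA hB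
    rw [← hdetQ0, h0, map_zero]
  have hdetLP : (L * PM).det = (Polynomial.X : Polynomial R) ^ (q * Fintype.card (Ball n e)) * Q.det := by
    rw [hfactor, Matrix.det_mul, Matrix.det_fromBlocks_zero₂₁, Matrix.det_one, one_mul, Matrix.det_smul,
      Matrix.det_one, mul_one, ← pow_mul]
  -- conclude
  intro hM0
  have : (L * PM).det = 0 := by rw [Matrix.det_mul, hdetPM, hM0, map_zero, mul_zero]
  rw [hdetLP] at this
  rcases mul_eq_zero.mp this with hX | hQ'
  · exact absurd hX (pow_ne_zero _ Polynomial.X_ne_zero)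
  · exact hdetQ hQ'
end Peel

/-! ## 6. Induction: the ball × ball Moore determinant is nonzero for every `n`, `e`, prime `p` -/
section Induction
/-- A ball of radius `0` has the single member `∅`. -/
theorem ball_eq_empty_of_radius_zero {n : ℕ} (S : Ball n 0) : S = ⟨∅, by simp⟩ :=
  Subtype.ext (Finset.card_eq_zero.mp (Nat.le_zero.mp S.2))

/-- A ball on `0` nodes has the single member `∅`. -/
theorem ball_eq_empty_of_nodes_zero {e : ℕ} (S : Ball 0 e) : S = ⟨∅, by simp⟩ :=
  Subtype.ext (Finset.eq_empty_of_isEmpty S.1)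

/-- `BB(n, 0)` is the `1 × 1` matrix `(η_∅ ^ 0) = (1)`. -/
theorem bbMatrix_det_radius_zero (n : ℕ) (d : Fin n → ℕ) : (bbMatrix p n 0 d).det = 1 := by
  have hcard : Fintype.card (Ball n 0) = 1 :=
    Fintype.card_eq_one_iff.mpr ⟨⟨∅, by simp⟩, ball_eq_empty_of_radius_zero⟩
  rw [Matrix.det_eq_elem_of_card_eq_one hcard ⟨∅, by simp⟩, bbMatrix, Matrix.of_apply]
  simp [ballWt]

/-- `BB(0, e)` is the `1 × 1` matrix `(1)`. -/
theorem bbMatrix_det_nodes_zero (e : ℕ) (d : Fin 0 → ℕ) : (bbMatrix p 0 e d).det = 1 := by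
  have hcard : Fintype.card (Ball 0 e) = 1 :=
    Fintype.card_eq_one_iff.mpr ⟨⟨∅, by simp⟩, ball_eq_empty_of_nodes_zero⟩
  rw [Matrix.det_eq_elem_of_card_eq_one hcard ⟨∅, by simp⟩, bbMatrix, Matrix.of_apply]
  simp [ballWt]

variable [Fact p.Prime]

/-- **The ball × ball Moore determinant is nonzero** in `𝔽_p[Y]` for every prime `p`, every number of nodes `n`,
every radius `e` and every strictly increasing digit-exponent map `d` (Pascal induction through the peel step). -/
theorem bbMatrix_det_ne_zero : ∀ (n e : ℕ) (d : Fin n → ℕ), StrictMono d → (bbMatrix p n e d).det ≠ 0 := by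
  intro n; induction n with
  | zero => intro e d _; rw [bbMatrix_det_nodes_zero]; exact one_ne_zero
  | succ n ih =>
    intro e d hd
    cases e with
    | zero => rw [bbMatrix_det_radius_zero]; exact one_ne_zero
    | succ e =>
      have hd' : StrictMono (d ∘ Fin.succ) := hd.comp (Fin.strictMono_succ)
      exact bbMatrix_det_ne_zero_peel p n e d (fun c => hd (Fin.succ_pos c)) (ih (e + 1) _ hd') (ih e _ hd')
end Induction

/-! ## 7. Back to the item's vocabulary: the class «BALL ROWS × BALL COLUMNS» of item 19717, every radius -/
section Item
variable [Fact p.Prime]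

/-- The canonical ball × ball generalized Vandermonde in the tree's variables `Option (Fin h)` (constant variable `none`),
exponents `Σ_{c ∈ W} p^c`: its determinant is nonzero in `𝔽_p[Y]`. -/
theorem mooreBall_ballColumns_det_ne_zero (h e : ℕ) :
    (Matrix.of fun S W : Ball h e =>
      ((X none + ∑ a ∈ S.1, X (some a) : MvPolynomial (Option (Fin h)) (ZMod p))) ^
        (∑ c ∈ W.1, p ^ (c : ℕ))).det ≠ 0 := by
  classical
  set ρ : MvPolynomial (Fin (h + 1)) (ZMod p) →ₐ[ZMod p] MvPolynomial (Option (Fin h)) (ZMod p) :=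
    rename (finSuccEquivLast : Fin (h + 1) ≃ Option (Fin h)) with hρ
  have hmat : ρ.mapMatrix (bbMatrix p h e fun c => (c : ℕ)) =
      Matrix.of fun S W : Ball h e =>
        ((X none + ∑ a ∈ S.1, X (some a) : MvPolynomial (Option (Fin h)) (ZMod p))) ^ (∑ c ∈ W.1, p ^ (c : ℕ)) := by
    refine Matrix.ext fun S W => ?_
    simp only [AlgHom.mapMatrix_apply, Matrix.map_apply, bbMatrix, Matrix.of_apply, map_pow, ballEta, ballWt,
      map_add, map_sum, hρ, rename_X, finSuccEquivLast_last, finSuccEquivLast_castSucc]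
  intro h0
  apply bbMatrix_det_ne_zero p h e (fun c => (c : ℕ)) Fin.val_strictMono
  apply MvPolynomial.rename_injective _ (finSuccEquivLast : Fin (h + 1) ≃ Option (Fin h)).injective
  have := ρ.map_det (bbMatrix p h e fun c => (c : ℕ))
  rw [hmat, h0] at this
  rw [map_zero, ← hρ]
  exact this

/-- **F_p on the ball-column layouts, any enumerations.** For rows running through the Hamming ball `B([h], e)`
(each subset of size `≤ e` exactly once, any order) and columns running through the same ball (any order), the
characteristic-`p` Moore determinant `det [η_{u i}^{Σ_{c∈w j} p^c}]` is nonzero — for EVERY prime `p`, every `h`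
and every radius `e`. -/
theorem frobDet_ne_zero_ballRows_ballColumns {h e r : ℕ} (u w : Fin r → Finset (Fin h))
    (hu : Function.Injective u) (hw : Function.Injective w)
    (husmall : ∀ i, (u i).card ≤ e) (huall : ∀ S : Finset (Fin h), S.card ≤ e → ∃ i, u i = S)
    (hwsmall : ∀ j, (w j).card ≤ e) (hwall : ∀ S : Finset (Fin h), S.card ≤ e → ∃ j, w j = S) :
    (Matrix.of fun i j : Fin r =>
      ((X none + ∑ a ∈ u i, X (some a) : MvPolynomial (Option (Fin h)) (ZMod p))) ^
        (∑ c ∈ w j, p ^ (c : ℕ))).det ≠ 0 := by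
  classical
  -- the two enumerations are bijections onto the ball
  let fu : Fin r → Ball h e := fun i => ⟨u i, husmall i⟩
  let fw : Fin r → Ball h e := fun j => ⟨w j, hwsmall j⟩
  have hfu : Function.Bijective fu :=
    ⟨fun i j hij => hu (congrArg Subtype.val hij), fun S => by
      obtain ⟨i, hi⟩ := huall S.1 S.2; exact ⟨i, Subtype.ext hi⟩⟩
  have hfw : Function.Bijective fw :=
    ⟨fun i j hij => hw (congrArg Subtype.val hij), fun S => by
      obtain ⟨j, hj⟩ := hwall S.1 S.2; exact ⟨j, Subtype.ext hj⟩⟩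
  set σu := Equiv.ofBijective fu hfu with hσu
  set σw := Equiv.ofBijective fw hfw with hσw
  set N : Matrix (Ball h e) (Ball h e) (MvPolynomial (Option (Fin h)) (ZMod p)) :=
    Matrix.of fun S W : Ball h e =>
      ((X none + ∑ a ∈ S.1, X (some a) : MvPolynomial (Option (Fin h)) (ZMod p))) ^ (∑ c ∈ W.1, p ^ (c : ℕ)) with hN
  set π : Equiv.Perm (Ball h e) := σu.symm.trans σw with hπ
  have hsub : (Matrix.of fun i j : Fin r =>
      ((X none + ∑ a ∈ u i, X (some a) : MvPolynomial (Option (Fin h)) (ZMod p))) ^ (∑ c ∈ w j, p ^ (c : ℕ))) =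
      (N.submatrix id π).submatrix σu σu := by
    refine Matrix.ext fun i j => ?_
    simp only [Matrix.submatrix_apply, hN, Matrix.of_apply, id, hπ, Equiv.trans_apply, hσu, hσw,
      Equiv.ofBijective_symm_apply_apply, Equiv.ofBijective_apply]
    rfl
  rw [hsub, Matrix.det_submatrix_equiv_self, Matrix.det_permute']
  have hN0 : N.det ≠ 0 := mooreBall_ballColumns_det_ne_zero p h e
  rcases Int.units_eq_one_or (Equiv.Perm.sign π) with h1 | h1 <;> simp [h1, hN0]

omit [Fact p.Prime] in
/-- **T1 on the ball-column layouts**: a numeric complex additive table with nonzero determinant exists for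
rows = `B([h], e)` (any order) × columns = `B([h], e)` (any order) — for every `h` and every radius `e`. -/
theorem ballRowsUniversal_ballColumns {h e r : ℕ} (u w : Fin r → Finset (Fin h))
    (hu : Function.Injective u) (hw : Function.Injective w)
    (husmall : ∀ i, (u i).card ≤ e) (huall : ∀ S : Finset (Fin h), S.card ≤ e → ∃ i, u i = S)
    (hwsmall : ∀ j, (w j).card ≤ e) (hwall : ∀ S : Finset (Fin h), S.card ≤ e → ∃ j, w j = S) :
    ∃ (ω₀ : Fin h → ℂ) (ω : Fin h → Fin h → ℂ),
      (Matrix.of fun i j : Fin r => ∏ c ∈ w j, (ω₀ c + ∑ a ∈ u i, ω a c)).det ≠ 0 :=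
  haveI : Fact (Nat.Prime 2) := ⟨Nat.prime_two⟩
  exists_table_of_frobenius_char 2 u w
    (frobDet_ne_zero_ballRows_ballColumns 2 u w hu hw husmall huall hwsmall hwall)

omit [Fact p.Prime] in
/-- **«BALL ROWS × BALL COLUMNS», EVERY RADIUS.** For `h ≥ 2`, every radius `e` and every layout whose rows run
through the Hamming ball `B([h], e)` (each subset of `Fin h` of size `≤ e` exactly once, in any order) and whose
columns run through the same ball (in any, possibly different, order) — `r = Σ_{k ≤ e} C(h, k)` rows, exponential
in `h` for `e = ⌊h/2⌋` — the partition minor is nonsingular at some `f ∈ SmallCircuits ℂ (h+h) 5`. Unconditional;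
through the characteristic-`2` Frobenius door. -/
theorem partitionMinor_hit_ballRows_ballColumns {h : ℕ} (hh : 2 ≤ h) {e r : ℕ} (u w : Fin r → Finset (Fin h))
    (hu : Function.Injective u) (hw : Function.Injective w)
    (husmall : ∀ i, (u i).card ≤ e) (huall : ∀ S : Finset (Fin h), S.card ≤ e → ∃ i, u i = S)
    (hwsmall : ∀ j, (w j).card ≤ e) (hwall : ∀ S : Finset (Fin h), S.card ≤ e → ∃ j, w j = S) :
    ∃ f ∈ SmallCircuits ℂ (h + h) 5,
      (Matrix.of fun i j : Fin r => MvPolynomial.coeff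
        (∑ a ∈ u i, Finsupp.single (Fin.castAdd h a) 1 +
          ∑ c ∈ w j, Finsupp.single (Fin.natAdd h c) 1) f).det ≠ 0 :=
  haveI : Fact (Nat.Prime 2) := ⟨Nat.prime_two⟩
  partitionMinor_hit_of_frobenius_char 2 hh u w
    (frobDet_ne_zero_ballRows_ballColumns 2 u w hu hw husmall huall hwsmall hwall)
end Item

end

end Summit.ValiantsHypothesis.ValiantsHypothesis.Theorems.BarrierLever.FrobeniusDoor
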